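import Summits.HubbardSuperconductivity.HubbardSuperconductivity.Theorems.AnisotropyChordTransferFibre3FinX3Eval

/-!
# Route `AnisotropyChord` / H0 rotor rung: FIN per-`L` GM₃ (X5), `L = 28` — rows `N₁` / D / side-condition cell facts, part `p43`

Kernel facts (`decide +kernel`) for cert cells 105, 106 of the per-`L` grid of `L = 28`: `xbnCellAny2` (row `N₁` on XB2 point wedges recomputed in the kernel, exporting the literal brackets `nt ⊇ T⁺ − 3λ₂` and `tb ⊇ T⁺·D`), `xdCellAnyN0` (row D, reads `nt`), `sdCellAnyZN` (side condition, reads `nt`); evaluators `…FinX3Eval` / `…FinX5Eval`; constants from the compiled design probe (x3probe/x3plan, margins c ×0.985, b ×1.03, aD ×1.03); assembled in `…FinX5GM3TwentyEight`.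
Prover seat `hubbard-h0-rotor-p3` g8; helper for piece A = stmt-HubbardSuperconductivity-23918 of rung 19089 (`--supports`, helper class).
WHAT THIS IS NOT: nothing here proves superconductivity in the Hubbard model (rotor TARGET as worded stays FALSE, g15 verdict); kernel facts for the FIN certificate of ONE conditional reduction.  Tree imports only; zero data; standard axioms.
-/

set_option linter.dupNamespace false
set_option autoImplicit false

namespace Summit.HubbardSuperconductivity.HubbardSuperconductivity.Theorems.AnisotropyChord.Transfer.Fibre3

namespace FinXD

open FinXB FinCell Hole2

set_option maxHeartbeats 4000000 in
/-- row `N₁` of cell 105 of `L = 28` (`c = 59/100`), exporting `nt`, `tb`. [folklore] -/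
theorem xn28_105 : xbnCellAny2 28 (49/50 : ℚ) 910514786326436 933277655984597 (59/100 : ℚ) ((4707326405663 : ℤ), (10434393552692 : ℤ)) ((2736235013361296 : ℤ), (2810284033530158 : ℤ)) = true := by decide +kernel

set_option maxHeartbeats 4000000 in
/-- row D of cell 105 of `L = 28` (`aD = 2/25`). [folklore] -/
theorem xd28_105 : xdCellAnyN0 28 (49/50 : ℚ) 910514786326436 933277655984597 (2/25 : ℚ) ((4707326405663 : ℤ), (10434393552692 : ℤ)) = true := by decide +kernel

set_option maxHeartbeats 4000000 in
/-- side condition of cell 105 of `L = 28` (`c, b = 82/100, aD`). [folklore] -/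
theorem sd28_105 : sdCellAnyZN 28 (49/50 : ℚ) 100 910514786326436 933277655984597 ((59/100 : ℚ), (82 : ℕ), (2/25 : ℚ)) ((4707326405663 : ℤ), (10434393552692 : ℤ)) = true := by decide +kernel

set_option maxHeartbeats 4000000 in
/-- row `N₁` of cell 106 of `L = 28` (`c = 59/100`), exporting `nt`, `tb`. [folklore] -/
theorem xn28_106 : xbnCellAny2 28 (49/50 : ℚ) 933277655984597 956609597384212 (59/100 : ℚ) ((5182967355231 : ℤ), (11031393538379 : ℤ)) ((2804998846484755 : ℤ), (2880877274515282 : ℤ)) = true := by decide +kernel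

set_option maxHeartbeats 4000000 in
/-- row D of cell 106 of `L = 28` (`aD = 2/25`). [folklore] -/
theorem xd28_106 : xdCellAnyN0 28 (49/50 : ℚ) 933277655984597 956609597384212 (2/25 : ℚ) ((5182967355231 : ℤ), (11031393538379 : ℤ)) = true := by decide +kernel

set_option maxHeartbeats 4000000 in
/-- side condition of cell 106 of `L = 28` (`c, b = 83/100, aD`). [folklore] -/
theorem sd28_106 : sdCellAnyZN 28 (49/50 : ℚ) 100 933277655984597 956609597384212 ((59/100 : ℚ), (83 : ℕ), (2/25 : ℚ)) ((5182967355231 : ℤ), (11031393538379 : ℤ)) = true := by decide +kernel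

end FinXD

end Summit.HubbardSuperconductivity.HubbardSuperconductivity.Theorems.AnisotropyChord.Transfer.Fibre3
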